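import Mathlib.Order.PiLex
import Mathlib.Data.Fin.VecNotation
import Mathlib.Data.List.GetD
import Literature.AlgebraicGeometry.Hironaka2017.Datum
import Literature.AlgebraicGeometry.Hironaka2017.S04CharAlgebra.R007aInv
import HarnessLib

/-!
# Kill test K3.1 (LADDER-RESOLUTION rung L, slot W3.1 «u.s.c. first»): the ORDER CONVENTION of the typed `Inv`
# — Eq. (34) p.24 of [Hironaka2017] as typed in `S04CharAlgebra.invOfExponents` over `Datum.EdgeInv`

Cell `res-hironaka` (run/shared/lean/pub/res-hironaka/), seat `res-L1-k31`, pre-registration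
`L/res-L1-k31/PREREG-K3.1.md` (frozen 2026-08-26T18:08:48Z). HONEST FRAMING: every declaration below is an
elementary ORDER-THEORETIC fact about the TYPED value packaging
`Literature.AlgebraicGeometry.Hironaka2017.S04CharAlgebra.invOfExponents` (PARTITION row 007a, statements-first typing of
Eq. (34) p.24 l.29–31 «`Inv_ξ(E) = (n, n − r, q_1, q_2, ···, q_r)` with `n = dim Z`») and the tree's value type
`Literature.AlgebraicGeometry.Hironaka2017.Datum.EdgeInv` (0-padded key `(n, n − r, q_1, …, q_r, 0, …)` in
`Lex (Fin (n+2) → ℕ)`), or about the typed `IsInvmax` / `invmaxStratum` (p.30 l.3–8). NOTHING here is a statement of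
H. Hironaka's manuscript (2017-03-23, lit key `paper:url-3343fd9e678b`, [claim: Hironaka2017, status: under-review]) and
nothing asserts that any statement of it holds; the manuscript is quoted for locators only. «[OURS · L1 W3.1] kill-test
helper; NOT a statement of the manuscript.»

What is settled here (test T1 of the prereg, and the `invmaxStratum` clause):

* `lt_iff_r_lt_or_firstDiff` — the typed comparison is PADDING-FREE and decided by `r` FIRST: `v < w` iff `w` has FEWER
  edge generators than `v`, or the same number and the exponent strings differ first at a place where `v`'s exponent is
  smaller. (For two values in the same ambient dimension `n` the padding sentence of Th. 16.6 (2) p.84 l.17–20 never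
  intervenes: equal `n − r` forces equal length.)
* `lt_of_r_lt`, `r_le_r_of_lt` — more edge generators ⇒ strictly smaller `Inv`; `Inv` can only go up when `r` does not.
* THE SPECIMEN of the kill test, `Ê = (y² − x²z² + x⁵, 2)` on `𝔸³`, perfect base field of characteristic `3`: with the
  edge data re-derived in `L/res-L1-k31/KILL-TEST-K3.1.md` — `(r; q) = (2; 1, 1)` at a general closed point `Q` of
  `Sing(Ê)` (the `z`-axis) and `(1; 1)` at the origin `O` — the typed values are `invOfExponents 3 [1,1]` and
  `invOfExponents 3 [1]`, with keys `(3,1,1,1,0)` and `(3,2,1,0,0)` (`key_inv_axis`, `key_inv_origin`), and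
  `inv_axis_lt_inv_origin`: the value at the SPECIAL point is the LARGER one — an INCREASE under specialisation, the
  direction upper semicontinuity of `ξ ↦ Inv_ξ(Ê)` demands. The counterfactual `counterfactual_slot_r_reverses`: had the
  second slot been `r` instead of `n − r`, the same pair of tuples would compare the other way.
* `invmaxStratum_ne_of_ne` — the typed `Invmax`-stratum of a set `S` is NOT all of `S` as soon as the function takes two
  different values on `S` (whatever the order convention decides about WHICH value is larger): the (43)/(44) clash recorded
  in the cell's GAP row R12 consumes only this; `isInvmax_origin`, `invmaxStratum_eq_singleton_origin` — on the specimen's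
  two-valued pattern the typed `Invmax` is the origin's value and the stratum is `{O}`.

Host item (kill-test protocol «--supports <item> --as helper»): MarkedTransfer `HypersurfaceOrderReduction`
(stmt-ResolutionOfSingularities-16155) — the specimen is a marked hypersurface ideal `(𝔸³, (f), ∅, 2)` of exactly its type and
`Inv` is a candidate secondary invariant refining `ord` on `{ord ≥ 2}`; this file decides in which direction that candidate
moves under specialisation. No new route, no new item.

## References
* H. Hironaka, *Resolution of singularities in positive characteristics*, manuscript 2017-03-23 [Hironaka2017]:
  Eq. (34) p.24 l.29–31; Rem. 4.7 / Def. 4.9 p.20; Def. 4.11 / Eq. (28) p.21; p.30 l.3–8 (Invmax, Eq. (43));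
  Th. 7.1 p.35 l.12–20 («never increase in the sense of lexicographical ordering»); Th. 16.6 (2) p.84 l.17–20 — locators only.
* Cell files: `plan/RESCUE-SEED.md` §1 W3.1; `ledger/group-3/DOSSIER.md` §6 Q4 (res-adj-3); prior index
  `papers/ResolutionOfSingularities/hironaka-charp/GAP.md` §7.1 (INDEX ONLY, re-derived).
-/

set_option linter.dupNamespace false -- mandated namespace of this single-conjunct summit

namespace Summit.ResolutionOfSingularities.ResolutionOfSingularities.Theorems.InvOrderConvention

open Literature.AlgebraicGeometry.Hironaka2017.Datum
open Literature.AlgebraicGeometry.Hironaka2017.S04CharAlgebra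

variable {n : ℕ}

/-! ## 1. The typed order on `Inv` values is decided by `r` first and involves no padding -/

/-- Entry `0` of the typed key is the ambient dimension `n` for every value (Eq. (34): first component `n = dim Z`).
[OURS · L1 W3.1] elementary; NOT a statement of the manuscript. -/
theorem key_apply_zero (v : EdgeInv n) : ofLex v.key ⟨0, by omega⟩ = n := by
  simp [EdgeInv.key]

/-- **More edge generators ⇒ strictly smaller `Inv`** in the typed order (the second slot is `n − r`): a restatement of the
tree lemma `Datum.EdgeInv.key_lt_of_length_lt` in terms of `<` on `EdgeInv n` and `EdgeInv.r`.
[OURS · L1 W3.1] elementary; NOT a statement of the manuscript. -/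
theorem lt_of_r_lt (v w : EdgeInv n) (h : w.r < v.r) : v < w :=
  (EdgeInv.lt_iff v w).2 (EdgeInv.key_lt_of_length_lt w v h)

/-- **`Inv` rises only if `r` does not**: `v < w` forces `r(w) ≤ r(v)`.
[OURS · L1 W3.1] elementary; NOT a statement of the manuscript. -/
theorem r_le_r_of_lt (v w : EdgeInv n) (h : v < w) : w.r ≤ v.r := by
  by_contra hlt
  have h' : w < v := lt_of_r_lt w v (lt_of_not_ge hlt)
  exact lt_asymm ((EdgeInv.lt_iff v w).1 h) ((EdgeInv.lt_iff w v).1 h')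

/-- `≤` on typed `Inv` values is `<` or `=` (the padded key is injective, `Datum.EdgeInv.key_injective`).
[OURS · L1 W3.1] elementary; NOT a statement of the manuscript. -/
theorem le_iff_lt_or_eq (v w : EdgeInv n) : v ≤ w ↔ v < w ∨ v = w := by
  constructor
  · intro h
    rcases (show v.key ≤ w.key from h).lt_or_eq with h' | h'
    · exact Or.inl h'
    · exact Or.inr (EdgeInv.key_injective h')
  · rintro (h | rfl)
    · exact (show v.key < w.key from h).le
    · exact (le_refl v.key : v.key ≤ v.key)

/-- Antisymmetry of `≤` on typed `Inv` values. [OURS · L1 W3.1] elementary; NOT a statement of the manuscript. -/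
theorem le_antisymm' (v w : EdgeInv n) (h₁ : v ≤ w) (h₂ : w ≤ v) : v = w :=
  EdgeInv.key_injective (le_antisymm (show v.key ≤ w.key from h₁) (show w.key ≤ v.key from h₂))

/-- **The typed comparison is padding-free and decided by `r` first.** For two values `v, w : EdgeInv n`
(same ambient dimension `n`): `v < w` iff EITHER `w` has fewer edge generators (`r(w) < r(v)`, i.e. `n − r(v) < n − r(w)`),
OR `r(v) = r(w)` and the exponent strings `q(v)`, `q(w)` (then of the same length) first differ at an index `k < r` with
`q(v)_k < q(w)_k`. In particular the 0-padding of the key never decides a comparison of two `Inv` values.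
[OURS · L1 W3.1] elementary; NOT a statement of the manuscript. -/
theorem lt_iff_r_lt_or_firstDiff (v w : EdgeInv n) :
    v < w ↔ w.r < v.r ∨ (v.r = w.r ∧ ∃ k, k < v.r ∧ (∀ m, m < k → v.q.getD m 0 = w.q.getD m 0) ∧
      v.q.getD k 0 < w.q.getD k 0) := by
  have hv : v.r ≤ n := v.r_le
  have hw : w.r ≤ n := w.r_le
  constructor
  · rintro ⟨i, hi, hlt⟩
    rcases i with ⟨i, hi'⟩
    rcases i with _ | _ | i
    · simp [EdgeInv.key] at hlt
    · left
      simp [EdgeInv.key] at hlt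
      omega
    · right
      have h1 : ofLex v.key ⟨1, by omega⟩ = ofLex w.key ⟨1, by omega⟩ := hi ⟨1, by omega⟩ (by simp [Fin.lt_def])
      simp [EdgeInv.key] at h1
      have hr : v.r = w.r := by omega
      refine ⟨hr, i, ?_, ?_, ?_⟩
      · -- if `i ≥ r` both padded entries are `0`, contradicting the strict inequality
        by_contra hki
        have hvi : v.q[i]? = none := List.getElem?_eq_none (by unfold EdgeInv.r at hki; omega)
        have hwi : w.q[i]? = none := List.getElem?_eq_none (by unfold EdgeInv.r at hr hki; omega)
        simp [EdgeInv.key, hvi, hwi] at hlt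
      · intro m hm
        have := hi ⟨m + 2, by omega⟩ (by simp [Fin.lt_def]; omega)
        simpa [EdgeInv.key] using this
      · simpa [EdgeInv.key] using hlt
  · rintro (h | ⟨hr, k, hk, heq, hlt⟩)
    · exact lt_of_r_lt v w h
    · refine ⟨⟨k + 2, by omega⟩, fun j hj => ?_, ?_⟩
      · rcases j with ⟨j, hj'⟩
        rcases j with _ | _ | j
        · simp [EdgeInv.key]
        · simp [EdgeInv.key, hr]
        · have hjk : j < k := by simp [Fin.lt_def] at hj; omega
          simpa [EdgeInv.key] using heq j hjk
      · simpa [EdgeInv.key] using hlt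

/-! ## 2. The specimen of K3.1: `invOfExponents 3 [1,1]` (general point of the axis) vs `invOfExponents 3 [1]` (origin) -/

/-- The typed value at a general closed point `Q` of `Sing(Ê)` for the re-derived edge data `(r; q) = (2; 1, 1)` has key
`(3, 1, 1, 1, 0)` — printed tuple `(n, n − r, q_1, q_2) = (3, 1, 1, 1)`, one padding zero.
[OURS · L1 W3.1] elementary; NOT a statement of the manuscript. -/
theorem key_inv_axis (h₁ : [1, 1].length ≤ 3) (h₂ : ∀ x ∈ [1, 1], 1 ≤ x) :
    (invOfExponents 3 [1, 1] h₁ h₂).key = toLex ![3, 1, 1, 1, 0] := by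
  unfold invOfExponents EdgeInv.key
  refine congrArg toLex (funext fun i => ?_)
  fin_cases i <;> rfl

/-- The typed value at the origin `O` for the re-derived edge data `(r; q) = (1; 1)` has key `(3, 2, 1, 0, 0)` — printed
tuple `(n, n − r, q_1) = (3, 2, 1)`, two padding zeros. [OURS · L1 W3.1] elementary; NOT a statement of the manuscript. -/
theorem key_inv_origin (h₁ : [1].length ≤ 3) (h₂ : ∀ x ∈ [1], 1 ≤ x) :
    (invOfExponents 3 [1] h₁ h₂).key = toLex ![3, 2, 1, 0, 0] := by
  unfold invOfExponents EdgeInv.key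
  refine congrArg toLex (funext fun i => ?_)
  fin_cases i <;> rfl

/-- **K3.1, test T1 (decisive): under the typed convention the jump at the special point is an INCREASE.**
`invOfExponents 3 [1,1] < invOfExponents 3 [1]`, i.e. `(3,1,1,1) <lex (3,2,1)`: the value at the origin `O` (fewer edge
generators, `r = 1`) is strictly LARGER than the value at a general closed point of the axis (`r = 2`) — the direction upper
semicontinuity of `ξ ↦ Inv_ξ(Ê)` along `Sing(Ê)` demands (`O` is a specialisation of the general axis point). Decided in the
slot `n − r`; no padding and no exponent is consulted. [OURS · L1 W3.1] elementary; NOT a statement of the manuscript. -/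
theorem inv_axis_lt_inv_origin (h₁ : [1, 1].length ≤ 3) (h₂ : ∀ x ∈ [1, 1], 1 ≤ x) (h₃ : [1].length ≤ 3)
    (h₄ : ∀ x ∈ [1], 1 ≤ x) : invOfExponents 3 [1, 1] h₁ h₂ < invOfExponents 3 [1] h₃ h₄ :=
  lt_of_r_lt _ _ (by show ([1] : List ℕ).length < ([1, 1] : List ℕ).length; decide)

/-- The same comparison stated on the explicit padded keys: `(3,1,1,1,0) < (3,2,1,0,0)` in `Lex (Fin 5 → ℕ)`, witnessed at
index `1` (the `n − r` slot). [OURS · L1 W3.1] elementary; NOT a statement of the manuscript. -/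
theorem key_axis_lt_key_origin : (toLex ![3, 1, 1, 1, 0] : Lex (Fin 5 → ℕ)) < toLex ![3, 2, 1, 0, 0] :=
  ⟨⟨1, by omega⟩, fun j hj => by
    rcases j with ⟨_ | j, hj'⟩
    · rfl
    · simp [Fin.lt_def] at hj, by decide⟩

/-- **Counterfactual convention.** Had the second slot of Eq. (34) been the NUMBER of edge generators `r` (instead of
`n − r` as printed and typed), the specimen's tuples would be `(3, 2, 1, 1)` at the axis point and `(3, 1, 1)` at the origin,
and the padded comparison would come out THE OTHER WAY: `(3,1,1,0,0) < (3,2,1,1,0)` — the special point would carry the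
SMALLER value, a DECREASE under specialisation, incompatible with upper semicontinuity along the axis. This is the only way the
direction could flip; the typed decls do not take it. [OURS · L1 W3.1] elementary; NOT a statement of the manuscript. -/
theorem counterfactual_slot_r_reverses :
    (toLex ![3, 1, 1, 0, 0] : Lex (Fin 5 → ℕ)) < toLex ![3, 2, 1, 1, 0] :=
  ⟨⟨1, by omega⟩, fun j hj => by
    rcases j with ⟨_ | j, hj'⟩
    · rfl
    · simp [Fin.lt_def] at hj, by decide⟩

/-! ## 3. The typed `Invmax`-stratum on a two-valued pattern (the R12 clause of the prereg) -/

variable {P : Type*}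

/-- **Convention-robustness of the (43)/(44) clash.** If an `EdgeInv n`-valued function takes two different values at points
of `S`, the typed `Invmax`-stratum `invmaxStratum S f` (Eq. (43) p.30 l.8 as typed in row 007a) is NOT all of `S` — whichever
of the two values the order convention declares larger. [OURS · L1 W3.1] elementary; NOT a statement of the manuscript. -/
theorem invmaxStratum_ne_of_ne (S : Set P) (f : P → EdgeInv n) {ξ₁ ξ₂ : P} (h₁ : ξ₁ ∈ S) (h₂ : ξ₂ ∈ S)
    (hne : f ξ₁ ≠ f ξ₂) : invmaxStratum S f ≠ S := by
  intro hS
  have h₁' : ξ₁ ∈ invmaxStratum S f := hS.symm ▸ h₁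
  have h₂' : ξ₂ ∈ invmaxStratum S f := hS.symm ▸ h₂
  exact hne (le_antisymm' _ _ (h₂'.2 ξ₁ h₁) (h₁'.2 ξ₂ h₂))

/-- On the specimen's pattern — value `invOfExponents 3 [1]` at the origin `O ∈ S` and `invOfExponents 3 [1,1]` at every other
point of `S` (`S` standing for the closed points of `Sing(Ê)` = the `z`-axis) — the typed `IsInvmax` holds with the ORIGIN's
value: `Invmax(Ê) = (3,2,1)` is attained, at `O`. [OURS · L1 W3.1] elementary; NOT a statement of the manuscript. -/
theorem isInvmax_origin (S : Set P) (O : P) (hO : O ∈ S) (f : P → EdgeInv 3)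
    (h₁ : [1, 1].length ≤ 3) (h₂ : ∀ x ∈ [1, 1], 1 ≤ x) (h₃ : [1].length ≤ 3) (h₄ : ∀ x ∈ [1], 1 ≤ x)
    (hfO : f O = invOfExponents 3 [1] h₃ h₄) (hfA : ∀ ξ ∈ S, ξ ≠ O → f ξ = invOfExponents 3 [1, 1] h₁ h₂) :
    IsInvmax S f (invOfExponents 3 [1] h₃ h₄) := by
  refine ⟨⟨O, hO, hfO⟩, fun η hη => ?_⟩
  by_cases hηO : η = O
  · subst hηO; rw [hfO]; exact (le_refl _ : (invOfExponents 3 [1] h₃ h₄).key ≤ _)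
  · rw [hfA η hη hηO]
    exact (show (invOfExponents 3 [1, 1] h₁ h₂).key < (invOfExponents 3 [1] h₃ h₄).key from
      inv_axis_lt_inv_origin h₁ h₂ h₃ h₄).le

/-- On the specimen's pattern the typed `Invmax`-stratum is the ORIGIN ALONE: `Σ_max(Ê) = {O}` — a closed point, strictly
smaller than `Sing(Ê)_cl` as soon as the axis has a second closed point. [OURS · L1 W3.1] elementary; NOT a statement of the
manuscript. -/
theorem invmaxStratum_eq_singleton_origin (S : Set P) (O : P) (hO : O ∈ S) (f : P → EdgeInv 3)
    (h₁ : [1, 1].length ≤ 3) (h₂ : ∀ x ∈ [1, 1], 1 ≤ x) (h₃ : [1].length ≤ 3) (h₄ : ∀ x ∈ [1], 1 ≤ x)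
    (hfO : f O = invOfExponents 3 [1] h₃ h₄) (hfA : ∀ ξ ∈ S, ξ ≠ O → f ξ = invOfExponents 3 [1, 1] h₁ h₂) :
    invmaxStratum S f = {O} := by
  ext ξ
  constructor
  · rintro ⟨hξ, hmax⟩
    by_contra hξO
    have hle := hmax O hO
    rw [hfO, hfA ξ hξ hξO] at hle
    exact absurd (inv_axis_lt_inv_origin h₁ h₂ h₃ h₄)
      (not_lt_of_ge (show (invOfExponents 3 [1] h₃ h₄).key ≤ (invOfExponents 3 [1, 1] h₁ h₂).key from hle))
  · intro h
    have hξ : ξ = O := h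
    rw [hξ]
    exact ⟨hO, fun η hη => by
      rw [hfO]; exact (isInvmax_origin S O hO f h₁ h₂ h₃ h₄ hfO hfA).2 η hη⟩

end Summit.ResolutionOfSingularities.ResolutionOfSingularities.Theorems.InvOrderConvention
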